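import Summits.BirchSwinnertonDyer.BirchSwinnertonDyer.Theses.KatoDescentTamePotSupersingular
import Summits.BirchSwinnertonDyer.BirchSwinnertonDyer.Theorems.KatoDescentTamePotSupersingularTameLowerKimRoad
import Summits.BirchSwinnertonDyer.BirchSwinnertonDyer.Theorems.KatoDescentTamePotSupersingularTameLowerFouquetRoadCited
import Summits.BirchSwinnertonDyer.BirchSwinnertonDyer.Theorems.KatoDescentTamePotSupersingularTameLowerFouquetRoadTate
import Summits.BirchSwinnertonDyer.BirchSwinnertonDyer.Theorems.KatoDescentTamePotSupersingularTameLowerFouquetFibreRoad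
import Summits.BirchSwinnertonDyer.BirchSwinnertonDyer.Theorems.KatoDescentTamePotSupersingularTameLowerFouquetFibreRoadLevel
import HarnessLib

/-!
ADOPTED as the REGISTERED skeleton v7 of item stmt-BirchSwinnertonDyer-19618 by planner bsd-potss-plan g23 (2026-08-27T13:1xZ):
seat bsd-potss-k8t-c2 g12/g13's certified candidate (HOME k8t-c2/g13/lean/TameLowerIntrinsicNonCM_birth_v7_certified.lean, sha16
5de522e5358bbfeb) byte-identical below this note; supersedes the registered v6 (sha c50aa3639ab5, archived as Lines/v6_fibreRows_g21.lean,
namespace .BirthV6). Desk contingency (bsd-cited C2 on S7 delta-1 at p = 5): PASS keeps v7; GAP triggers v8 = v7 + a displayed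
per-member lattice input at p = 5 inside stub_intr_publishedInputs (referee bsd-potss-ref g37 F7).
-/

/-!
**v7 CERTIFIED AGAINST THE TREE (seat bsd-potss-k8t-c2 g13, 2026-08-27T11:5xZ):** after the road p526820
(`…TameLowerFouquetFibreRoadLevel`, in the tree) and the twins p525876, this file elaborates on the farm with rc 0 / 0 errors /
sorries 6 (= the six stubs) and `tameLowerIntrinsicNonCM_of_stubs : TameLowerIntrinsicNonCM` concludes item 19618 BY NAME (audit class
`proof-of-item`, `closed=false` by `sorryAx` only); referee bsd-potss-ref g37 §4 CONFIRMED R2′ and asks for this v7 (watch item F7).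
STANDING AUDIT FLAG on the fibre disjuncts (not a change of this file): ARM-P reader r07 S7 (pub/bsd-cited/sheets/…S7-r07-a823a9b6.md,
10:33Z) grades the facts (A)/(B) — hence (A′)/(B′) — VERBATIM-COMPOSITE at `p ≥ 7` and GAPPED-PROVISIONAL at `p = 5` (Δ1: Kato
(12.5.2) / Skinner–Urban's lattice clause for NON-RATIONAL fibre members needs the `(2, 𝔽₅)` case that Manoharmayum 2015 excludes);
ADDENDUM-1 (…S7-ADDENDUM-1-r07-8b6e6fe2.md, 11:11Z) files a complete proof route for residual image `GL₂(𝔽₅)` (which `Surj W 5`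
gives) via `H¹(GL₂(𝔽₅), sl₂(𝔽₅)) = 0` (machine-checked ×3; in print: Arias-de-Reyna–Böckle ANT 2026 Rem 3.42 ← Flach 1992); the
desk word (C2) is pending. Every fibre-road row of the cell `(5; II*, v₅(c₄)=4)` is at `p = 5`. Contingency for the planner: desk
PASS ⇒ v7 as is; desk GAP ⇒ v8 = v7 with a DISPLAYED per-member lattice input at `p = 5` (sheet §E (β), `FibreLatticeInput 5`)
added to `stub_intr_publishedInputs` (honest: conditional tier, not citation tier) — NOT `7 ≤ p` (that empties the cell's fibre rows).
-/

/-!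
**skeleton v7 PROPOSAL (seat bsd-potss-k8t-c2 g12, 2026-08-27) = v6 + the R2′ AUDIT binder on the two Fouquet-2024 FIBRE
disjuncts.** Reading R2 of p518465 (fibre = trivial-character ordinary forms) holds only when `A_Σ = 1` for `Σ` = primes of
`p N_W`, i.e. when NO bad prime `ℓ ≠ p` of `W` has `ℓ ≡ 1 (mod p)`: otherwise the Λ-fibre over `O[[X₁,X₂,X₃]]` (Fouquet PMB 2024
pp. 26, 29, 36, 38) also holds the tame `p`-power twists `h ⊗ ψ̄` (nebentypus `ψ⁻² ≠ 1`), outside Skinner–Urban 3.6.4 («χ = 1»).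
`FibreRowB` / `FibreRowA` gain the conjunct `∀ ℓ, ℓ.Prime → ℓ ∣ N_W → ℓ ≠ p → ¬ p ∣ ℓ − 1` and are discharged inside `_of` by the
§4/§5 row forms `tameLowerHalf_fouquetFibre{Line,Shape}Rows_levelNotOneModP_of_fact` of the road file (k8t-c2 g12 append) over the
twins `Fouquet2024.padicValRat_bsd_rank_zero_of_ordinaryFibre{,_ellipticShape}_levelNotOneModP` (p525876), which replace (B)/(A) in
`stub_intr_publishedInputs`. The Kurihara stub keeps its text; since the fibre predicates got STRONGER its negative binders got WEAKER,
so its domain grows back by the rows with such an `ℓ` (cell `(5; II*, v₅(c₄)=4)`: +102 rows, +1 content row 317075h1) — a RESHAPE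
(stronger stub; no v6 proof existed). Other stubs byte-identical to v6. Memo HOME/k8t-c2/g12/FINDING-19981-pmb2024-fibre-audit-k8t-c2-g12.md.

**skeleton v6 (planner bsd-potss-plan g22, 2026-08-27T10:1xZ = seat bsd-potss-k8t-c2 g11's proposal ADOPTED byte-identical below this
paragraph; REGISTERED on item 19618).** ADOPTION NOTE: the two Fouquet-2024 FIBRE disjuncts rest on the cite-level facts of p518465, whose
readings R0–R6 (module docstring of `Literature/…/Fouquet2024/OrdinaryFibreRankZeroBSD.lean` + HOME/k8t-c2/g11/FINDING-19981-pmb2024-k8t-c2-g11.md)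
are the seat's audit; the referee's grade is asked (INBOX 09:59:18Z). A referee GAP on fact (B) (`…_of_ordinaryFibre`, seed-free) ⇒ v7 =
this file with `FibreRowB` deleted (its rows return to the Kurihara stub's domain; the `¬ FibreRowB W p →` binder goes) — on fact (A) likewise
for `FibreRowA`. Stub NAMES unchanged from v5 (6); ONE stub RESHAPED (weaker): `stub_intr_kuriharaCerts_offSeed`; `stub_intr_publishedInputs`
+= the two facts; the other four byte-identical to v5 (v5 registered sha 3d856c917d57, superseded).

**skeleton v6 PROPOSAL (seat bsd-potss-k8t-c2 g11, 2026-08-27).** v5 + the two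
FOUQUET-2024 ORDINARY-FIBRE disjuncts (Publ. Math. Besançon 2024 Thm 1.1 (iv)⇒(ii) + Prop. 3.9; facts p518465
`Fouquet2024.padicValRat_bsd_rank_zero_of_ordinaryFibre{_ellipticShape,}`; road `…TameLowerFouquetFibreRoad` p520558):
`FibreRowB W p` (SEED-FREE: `Surj`, a Steinberg prime `q ≢ ±1 (mod p)` with `p ∤ v_q(Δ_W)`, `Fouquet2024.HasOrdinaryLineNakamuraAt p W`)
and `FibreRowA W p` (the same shape certified by a congruent good-ordinary `G` with `p ∤ a_p(G)² − 1`) are tested BEFORE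
`SeedRowA/B`; the Kurihara stub `stub_intr_kuriharaCerts_offSeed` gains the negative binders `¬ FibreRowB W p → ¬ FibreRowA W p →`
(a RESHAPE of one registered stub: weaker than v5's, so every v5 proof of it would still serve; no stub proof has landed);
`stub_intr_publishedInputs` gains the two cite-level facts. All other stubs byte-identical. Census: road B removes 276 of the 700
(5; II*, v₅(c₄) = 4) rows (46 of 92 content; 9 content rows with no elliptic partner below 5·10⁵) from the Kurihara stub's domain
class-wide (memo HOME/k8t-c2/g11/FINDING-19981-pmb2024-k8t-c2-g11.md).

**skeleton v5 (plan g16, 2026-08-26T20:0xZ) — the R-05 RE-BASE of v4 on the printed Tate form of Fouquet 2025 Ass. 3.4 (5)(b).**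
v4 (plan g15 = seat k8t-c2 g5's v3 proposal) stated the seed rows and their roads through the binder `FouquetEligibleAt`
("`u_q` not a `p`-th power mod `q`"), which is the PRINTED clause only at `p = 3` (there `c₄³` is a cube); print reads, in Tate form,
`¬ ∃ x, x^p · c₄³ = u_q (mod q)` = `Fouquet2025.Assumption34TateAt p W` (p455826, bsd-littype-07). v5 swaps, in `SeedRowA` /
`SeedRowB`, `FouquetEligibleAt p W|G` ↦ `Fouquet2025.Assumption34TateAt p W|G`, the two cite-level facts ↦ their corrected twins
`Fouquet2025.padicValRat_bsd_rank_zero_of_ordinaryCongruence_nakamura_tate` (tier A, refereed chain via Nakamura 2023) /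
`…_sigma_tate` (tier B, Colmez–Wang preprint inside on `a_p(G)² ≡ 1`), and the seed discharge inside `_of` ↦ the re-landed roads
`Theorems.tameLowerHalf_fouquetSeedRows_of_nakamuraTateFact` / `…_of_sigmaTateFact` (k8t-c2 g6, p462359,
`Theorems/KatoDescentTamePotSupersingularTameLowerFouquetRoadTate.lean`; also there: the strict-Σ road `…_of_anyReductionFact` over
fact (A) and the pointer `assumption34TateAt_three_of_fouquetEligibleAt_three`). STUB NAMES UNCHANGED (6); the Kurihara / residual /
rung stubs are byte-identical to v4 except that `¬ SeedRowB W p` now refers to the Tate-form tier B. Domain effect of the re-base at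
`p = 5` (R-05 re-screen, evidence #11/#18 on this item; HOME/plan/edit-g16/rescreenC/): of the 3 799 (t′) `r_an = 0` rows, 362 carry a
level-raising prime `q ≡ 1 (5)`; verdicts same 3 622 / LEAVE 110 / ENTER 44 / prime-change 23; cell `L_{II*,5}` eligible 429 → 437;
the 85 eligible CONTENT rows (`5 ∣ #Ш_an`) keep verdict and tier (A 32+6 / B 22+4 / no-seed 15 / seeds-fail 6); of the register's 335
certified-seed rows exactly one (206800cu1, non-content, independently closed) loses its seeds. The BC5 rung's second technique is now
in the tree: `Theorems.tameLowerHalf_three_e4_rung_of_selmerCerts_of_deepRows` (p462525, Cassels–Tate lane: shallow classes by a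
`Sel₃ ≠ 0` certificate — instantiated on 894/894 tower classes `< 5·10⁵`, kit j257205/j257427 — deep classes by Kim-lane units).**

# BC3 birth skeleton — child crux `TameLowerIntrinsicNonCM` (item stmt-BirchSwinnertonDyer-19618, route KT
`KatoDescentTamePotSupersingular` rev 15/16; the OPEN CORE of the deciding crux L₀ `TameLowerHalfRankZero`
(19981) after the glued split of rev 10: CM rows and unit-member classes are discharged in the CLOSED glue
19623 by p439340; planner bsd-potss-plan g14/g15 + seat k8t-c2 g5, 2026-08-26)

The parent's registered skeleton v4 (`HOME/plan/edit-g11/bc/KT_TameLowerHalfRankZero_birth_v4.lean`, KIM ROAD)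
restricted to the INTRINSIC NON-CM (t′) classes (every isogenous member has `p ∣ #Ш_an`), with ONE new
input: the Fouquet-2025 SEED ROWS are discharged INSIDE the composition by the landed road
`Theorems.tameLowerHalf_fouquetSeedRows_of_fact` (k8t-c2 g5, 12:54Z) over the cite-level composite fact
`Fouquet2025.padicValRat_bsd_rank_zero_of_ordinaryCongruence` (p446173) — so the Kurihara-certificate
stub at `p ≥ 5` is only asked OFF the seed rows. Stubs (Sig format):

* `stub_intr_publishedInputs` — CITE-LEVEL typed inputs (Kim 2026 Thm 1.8 (6); rung W2's leaf Kim-at-3;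
  GZK; modularity; the Fouquet-2025 composite fact), not a prover target;
* `stub_intr_kuriharaCerts_offSeed` — `p ≥ 5`, `ρ̄` onto, intrinsic non-CM, NOT a Fouquet seed row: a
  Kurihara certificate of level `k ≤ ord_p ∏ c_ℓ + 1` (per pair decidable; class-wide = Kurihara's
  conjecture = Kato's IMC with `μ = 0`);
* `stub_intr_kuriharaCerts_three` — `p = 3`, `3`-adic tower onto, `E(ℚ₃)[3] = 0`, intrinsic non-CM: the
  level-shifted certificate;
* `stub_intr_residualNonCM` — the genuinely open residue: intrinsic non-CM rows with `p ≥ 5` and `ρ̄`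
  NOT onto (X3 ∩ (t′), Cartan normalisers, exceptional), or `p = 3` off-tower / with a local `3`-torsion
  point — Kato's Conj. 12.10 lower inclusion off every certificate road;
* `stub_intr_three_e4_rung` — BC5 PLAN-ONLY rung (OFF the sub-locus `L_{II*,5}`, which is `p = 5`): the
  `p = 3` tower-onto intrinsic non-CM (t′) rows (types III/III*, `e = 4`) from rung W2's leaf + level-shifted
  certificates; technique = `Theorems.tameLowerHalf_three_e4_rung_of_kimAtThree_of_certs_of_typeIIIRows`;
  outside S's known regime (no `p`-adic `L`-function / IMC at an additive potentially supersingular `3` in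
  print). Not consumed by `_of`.

Sources: Kim2026 (AJM 148 Thm 1.8 (6)), Kim2025RefinedTNC, Kurihara2014b, Kato2004Asterisque (Conj. 12.10,
Thm 17.4, §17.13), Fouquet2025EquivariantTNC (Thm 4.1, Thm 1.7 (2), Ass. 2.9/3.4), SkinnerUrban2014 (Thm 3.6.9),
Venjakob2007BSDviaETNC, GrossZagier1986, Kolyvagin1990.
-/

noncomputable section

open scoped Classical MatrixGroups ModularForm

namespace Summit.BirchSwinnertonDyer.BirchSwinnertonDyer.Cruxes.TameLowerIntrinsicNonCM.Birth

open CongruenceSubgroup WeierstrassCurve Literature.NumberTheory.EllipticCurves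
  Literature.NumberTheory.EllipticCurves.ModularForms
  Literature.NumberTheory.EllipticCurves.Rank1Residual
  Literature.NumberTheory.EllipticCurves.Rank1Residual.Typed
  Summit.BirchSwinnertonDyer.Rank1Residual Summit.BirchSwinnertonDyer.Rank1Residual.Additive
  Summit.BirchSwinnertonDyer.BirchSwinnertonDyer.Theorems
  Summit.BirchSwinnertonDyer.BirchSwinnertonDyer.Theses.KatoDescentTamePotSupersingular

/-- A (t′) rank-0 class is INTRINSIC at `p` when every globally minimal isogenous member has
`p ∣ #Ш_an` — the child's displayed hypothesis, verbatim. -/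
abbrev Intrinsic (W : WeierstrassCurve ℚ) [W.IsElliptic] (p : ℕ) [Fact p.Prime] : Prop :=
  ∀ (W' : WeierstrassCurve ℚ) [W'.IsElliptic] [W'.IsGloballyMinimal], IsIsogenous W W' →
    ∀ q' : ℚ, shaAn W' = (q' : ℂ) → 0 < padicValRat p q'

/-- A Fouquet SEED ROW at `p`, TIER A (k8t-c2 g5 v3 display = D-AUDIT §1d): Ass. 2.9 (2) exact, Ass. 3.4 on `LR(W)`, and a
congruent good-ordinary Skinner–Urban seed `G` with `p ∤ a_p(G)² − 1` (Nakamura 2023 Thm 1.1 (4): the zeta morphism of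
Fouquet's Thm 2.10 is then PUBLISHED print), `ρ̄_{G,p}` onto, a ramified multiplicative prime, the trace congruence, and
Ass. 3.4 on `LR(G)` (Σ = primes of `p N_W N_G`: level-RAISING seeds allowed) — verbatim the row hypotheses of
`Theorems.tameLowerHalf_fouquetSeedRows_of_nakamuraTateFact` (p462359; v4: `…_of_nakamuraFact` p452635), Ass. 3.4 (5)(b) in the
printed TATE form `Fouquet2025.Assumption34TateAt` (v5). -/
abbrev SeedRowA (W : WeierstrassCurve ℚ) [W.IsElliptic] [W.IsGloballyMinimal] (p : ℕ) [Fact p.Prime] :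
    Prop :=
  FouquetGenericAt p W ∧ Fouquet2025.Assumption34TateAt p W ∧
    ∃ (G : WeierstrassCurve ℚ) (_ : G.IsElliptic) (_ : G.IsGloballyMinimal),
      GoodOrd G p ∧ ¬ (p : ℤ) ∣ (G.frobeniusTrace p) ^ 2 - 1 ∧ Surj G p ∧ Ram G p ∧ IsCongruentModP p W G ∧
        Fouquet2025.Assumption34TateAt p G

/-- A Fouquet SEED ROW at `p`, TIER B (any congruent good-ordinary seed, Σ = primes of `p N_W N_G`) — verbatim the row
hypotheses of `Theorems.tameLowerHalf_fouquetSeedRows_of_sigmaTateFact` (p462359; v4: `…_of_sigmaFact` p449887; Tate form v5). On the rows of tier B that are not of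
tier A (`a_p(G)² ≡ 1 (mod p)`) Fouquet's Thm 2.10 rests on the Colmez–Wang PREPRINT (D-AUDIT §1d), which is why its
cite-level input is displayed SEPARATELY (`stub_intr_seedInputPRE`). `SeedRowA W p → SeedRowB W p` trivially. -/
abbrev SeedRowB (W : WeierstrassCurve ℚ) [W.IsElliptic] [W.IsGloballyMinimal] (p : ℕ) [Fact p.Prime] :
    Prop :=
  FouquetGenericAt p W ∧ Fouquet2025.Assumption34TateAt p W ∧
    ∃ (G : WeierstrassCurve ℚ) (_ : G.IsElliptic) (_ : G.IsGloballyMinimal),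
      GoodOrd G p ∧ Surj G p ∧ Ram G p ∧ IsCongruentModP p W G ∧ Fouquet2025.Assumption34TateAt p G

/-- A Fouquet-2024 FIBRE ROW at `p`, SEED-FREE form (k8t-c2 g11): `ρ̄` onto, a Steinberg prime `q ≠ p` of `W` with
`p ∤ v_q(Δ_W)` and `q ≢ ±1 (mod p)` (Skinner–Urban's (ram) for every member of the ordinary fibre), and an ordinary residual
line at `p` with Nakamura's condition displayed on `W[p]|G_ℚₚ` — verbatim the row hypotheses of
`Theorems.tameLowerHalf_fouquetFibreLineRows_levelNotOneModP_of_fact` (k8t-c2 g12 append; v6: `…_of_fact`, p520558) — v7 adds the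
R2′ binder «no bad `ℓ ≠ p` with `ℓ ≡ 1 (mod p)`» (`A_Σ = 1`). NO Ass. 2.9 (2) / Ass. 3.4 binder, NO partner. -/
abbrev FibreRowB (W : WeierstrassCurve ℚ) [W.IsElliptic] [W.IsGloballyMinimal] (p : ℕ) [Fact p.Prime] : Prop :=
  Surj W p ∧
    (∃ ℓ : ℕ, ∃ _ : Fact ℓ.Prime, ℓ ≠ p ∧ W.HasMultiplicativeReductionAtPrime ℓ ∧
      ¬ p ∣ padicValInt ℓ W.minimalDiscriminantInt ∧ ¬ p ∣ ℓ - 1 ∧ ¬ p ∣ ℓ + 1) ∧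
    -- v7 (R2′): `A_Σ = 1` — no bad prime `ℓ ≠ p` of `W` is `≡ 1 (mod p)`
    (∀ ℓ : ℕ, ℓ.Prime → ℓ ∣ W.conductorNorm ℤ → ℓ ≠ p → ¬ p ∣ ℓ - 1) ∧
    Fouquet2024.HasOrdinaryLineNakamuraAt p W

/-- A Fouquet-2024 FIBRE ROW at `p`, SHAPE-WITNESS form (k8t-c2 g11): as `FibreRowB` but the residual shape and Nakamura's
condition are certified by a congruent good-ORDINARY elliptic curve `G` with `p ∤ a_p(G)² − 1` (the congruence displayed as
`IsCongruentModP p W G`; the road's binder is its unfolding) — verbatim the row hypotheses of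
`Theorems.tameLowerHalf_fouquetFibreShapeRows_levelNotOneModP_of_fact` (k8t-c2 g12 append; v6: `…_of_fact`, p520558) — v7 adds
the R2′ binder. -/
abbrev FibreRowA (W : WeierstrassCurve ℚ) [W.IsElliptic] [W.IsGloballyMinimal] (p : ℕ) [Fact p.Prime] : Prop :=
  Surj W p ∧
    (∃ ℓ : ℕ, ∃ _ : Fact ℓ.Prime, ℓ ≠ p ∧ W.HasMultiplicativeReductionAtPrime ℓ ∧
      ¬ p ∣ padicValInt ℓ W.minimalDiscriminantInt ∧ ¬ p ∣ ℓ - 1 ∧ ¬ p ∣ ℓ + 1) ∧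
    -- v7 (R2′): `A_Σ = 1` — no bad prime `ℓ ≠ p` of `W` is `≡ 1 (mod p)`
    (∀ ℓ : ℕ, ℓ.Prime → ℓ ∣ W.conductorNorm ℤ → ℓ ≠ p → ¬ p ∣ ℓ - 1) ∧
    ∃ (G : WeierstrassCurve ℚ) (_ : G.IsElliptic) (_ : G.IsGloballyMinimal),
      GoodOrd G p ∧ ¬ (p : ℤ) ∣ (G.frobeniusTrace p) ^ 2 - 1 ∧ IsCongruentModP p W G

/-- Statement of `stub_intr_publishedInputs` (CITE-LEVEL typed inputs, not a prover target; v5: the Fouquet tier-A fact in its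
corrected Tate-form twin `…_nakamura_tate`, appended to `Literature/…/Fouquet2025/OrdinaryCongruenceRankZeroBSDNakamura.lean`). -/
abbrev Sig.stub_intr_publishedInputs : Prop :=
  Kim2026.rankZero_le_padicValNat_sha_of_kuriharaNumber_ne_zero ∧ N11.KimAtThreeRankZeroPUB ∧
    rank_eq_analyticRank_of_analyticRank_le_one ∧ hasEntireLFunction_rat ∧
    Fouquet2025.padicValRat_bsd_rank_zero_of_ordinaryCongruence_nakamura_tate ∧
    Fouquet2024.padicValRat_bsd_rank_zero_of_ordinaryFibre_levelNotOneModP ∧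
    Fouquet2024.padicValRat_bsd_rank_zero_of_ordinaryFibre_ellipticShape_levelNotOneModP

/-- Statement of `stub_intr_seedInputPRE` (CITE-LEVEL typed input WITH A PREPRINT INSIDE ITS CHAIN on part of its domain,
displayed separately, not a prover target): the Σ-form Fouquet ordinary-seed fact in its corrected Tate-form twin `…_sigma_tate` (v5; v4: p449673) — its zeta-morphism input on the rows
with `a_p(G)² ≡ 1 (mod p)` is Colmez–Wang arXiv:2104.09200 (PRE); flag `@Fouquet-2.10-via-ColmezWang-PRE` (D-AUDIT §1d). -/
abbrev Sig.stub_intr_seedInputPRE : Prop :=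
  Fouquet2025.padicValRat_bsd_rank_zero_of_ordinaryCongruence_sigma_tate

/-- Statement of `stub_intr_kuriharaCerts_offSeed`: a Kurihara certificate on every INTRINSIC NON-CM (t′)
`r_an = 0` row at `p ≥ 5` with `ρ̄_{E,p}` onto that is NOT a Fouquet seed row (certificate body verbatim
the parent's `hKur`). [cite: Kurihara2014b, Thm. B] [cite: Kim2026, Thm. 1.8 (6)] -/
abbrev Sig.stub_intr_kuriharaCerts_offSeed : Prop :=
  ∀ (W : WeierstrassCurve ℚ) [W.IsElliptic] [W.IsGloballyMinimal] (p : ℕ) [Fact p.Prime],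
      W.analyticRank = 0 → 5 ≤ p → Addv W p → SubTprime W p → Surj W p → ¬ W.HasCM → Intrinsic W p →
      ¬ FibreRowB W p → ¬ FibreRowA W p → ¬ SeedRowB W p →
        ∃ (N : ℕ) (_ : NeZero N) (D : ModularParametrizationData W N),
          ¬ (p : ℤ) ∣ D.maninConstant ∧
          (∃ u : ℚ, ‖(u : ℚ_[p])‖ = 1 ∧ W.realPeriodRat = u * plusPeriod D.f) ∧
          ∃ (k n : ℕ) (_ : NeZero n), 1 ≤ k ∧ k ≤ padicValNat p W.tamagawaProduct + 1 ∧
            Kato.IsKolyvaginProduct W p k n ∧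
            (∀ (ℓ : ℕ) [Fact ℓ.Prime], ℓ ∣ n →
              Nat.card {P : ((WeierstrassCurve.integralModelInt W).map
                  (Int.castRingHom (ZMod ℓ))).toAffine.Point // p • P = 0} ≤ p) ∧
            ∃ ψ : (ℓ : ℕ) → (ZMod ℓ)ˣ →* Multiplicative (ZMod (p ^ k)),
              (∀ ℓ ∈ n.primeFactors, Function.Surjective (ψ ℓ)) ∧
                kuriharaNumber D.f (p ^ k) n ψ ≠ 0

/-- Statement of `stub_intr_kuriharaCerts_three`: the level-shifted certificate at `p = 3` on the INTRINSIC
NON-CM rows with the `3`-adic tower onto and no local `3`-torsion. [cite: Kim2025RefinedTNC, Thm. 1.1/1.2] -/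
abbrev Sig.stub_intr_kuriharaCerts_three : Prop :=
  ∀ (W : WeierstrassCurve ℚ) [W.IsElliptic] [W.IsGloballyMinimal] [Fact (3 : ℕ).Prime],
      W.analyticRank = 0 → Addv W 3 → SubTprime W 3 →
      (∀ n : ℕ, W.HasSurjectiveModNGaloisRep (3 ^ n : ℕ)) →
      Nat.card {Q : (W.baseChange ℚ_[3]).toAffine.Point // (3 : ℕ) • Q = 0} = 1 →
      ¬ W.HasCM → Intrinsic W 3 →
        ∃ (N : ℕ) (_ : NeZero N) (D : ModularParametrizationData W N),
          ¬ (3 : ℤ) ∣ D.maninConstant ∧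
          (∃ u : ℚ, ‖(u : ℚ_[3])‖ = 1 ∧ W.realPeriodRat = u * plusPeriod D.f) ∧
          ∃ (k n : ℕ) (_ : NeZero n), 1 ≤ k ∧ k - 1 ≤ padicValNat 3 W.tamagawaProduct ∧
            Kato.IsKolyvaginProduct W 3 k n ∧
            (∀ (ℓ : ℕ) [Fact ℓ.Prime], ℓ ∣ n →
              Nat.card {P : ((WeierstrassCurve.integralModelInt W).map
                  (Int.castRingHom (ZMod ℓ))).toAffine.Point // 3 • P = 0} ≤ 3) ∧
            ∃ ψ : (ℓ : ℕ) → (ZMod ℓ)ˣ →* Multiplicative (ZMod (3 ^ k)),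
              (∀ ℓ ∈ n.primeFactors, Function.Surjective (ψ ℓ)) ∧
                kuriharaNumber D.f (3 ^ k) n ψ ≠ 0

/-- Statement of `stub_intr_residualNonCM`: L₀ on the INTRINSIC NON-CM residual rows — `p ≥ 5` with `ρ̄`
not onto, or `p = 3` off-tower / with a local `3`-torsion point. Genuinely open (Kato's Conj. 12.10 lower
inclusion off every certificate road and off the Fouquet seed rows). [cite: Kato2004Asterisque, Conj. 12.10] -/
abbrev Sig.stub_intr_residualNonCM : Prop :=
  ∀ (W : WeierstrassCurve ℚ) [W.IsElliptic] [W.IsGloballyMinimal] (p : ℕ) [Fact p.Prime],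
      W.analyticRank = 0 → p ≠ 2 → Addv W p → SubTprime W p →
      ¬ ((5 ≤ p ∧ Surj W p) ∨
          (p = 3 ∧ (∀ n : ℕ, W.HasSurjectiveModNGaloisRep (p ^ n : ℕ)) ∧
            Nat.card {Q : (W.baseChange ℚ_[p]).toAffine.Point // (p : ℕ) • Q = 0} = 1)) →
        ¬ W.HasCM → Intrinsic W p → MissingLowerBoundAt W p

/-- Statement of the BC5 PLAN-ONLY rung `stub_intr_three_e4_rung` (`p = 3`, OFF `L_{II*,5}`; not consumed
by `_of`): L₀ on the `3`-adic-tower-onto INTRINSIC NON-CM (t′) rows at `3`. Techniques in the tree (both conclude this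
statement verbatim from displayed per-row inputs): Kim lane `Theorems.tameLowerHalf_three_e4_rung_of_kimAtThree_of_certs_of_typeIIIRows`;
Cassels–Tate lane `Theorems.tameLowerHalf_three_e4_rung_of_selmerCerts_of_deepRows` (p462525: shallow classes `v₃(#Ш_an) ≤ 2` by a
`Sel₃(W) ≠ 0` certificate, deep classes by Kim-lane units). [cite: Kim2025RefinedTNC, Thm. 1.1/1.2] [cite: Cassels1962, Thm. 1.1] -/
abbrev Sig.stub_intr_three_e4_rung : Prop :=
  ∀ (W : WeierstrassCurve ℚ) [W.IsElliptic] [W.IsGloballyMinimal] [Fact (3 : ℕ).Prime],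
    W.analyticRank = 0 → Addv W 3 → SubTprime W 3 →
    (∀ n : ℕ, W.HasSurjectiveModNGaloisRep (3 ^ n : ℕ)) → ¬ W.HasCM → Intrinsic W 3 →
      MissingLowerBoundAt W 3

theorem stub_intr_publishedInputs : Sig.stub_intr_publishedInputs := by
  sorry

theorem stub_intr_seedInputPRE : Sig.stub_intr_seedInputPRE := by
  sorry

theorem stub_intr_kuriharaCerts_offSeed : Sig.stub_intr_kuriharaCerts_offSeed := by
  sorry

theorem stub_intr_kuriharaCerts_three : Sig.stub_intr_kuriharaCerts_three := by
  sorry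

theorem stub_intr_residualNonCM : Sig.stub_intr_residualNonCM := by
  sorry

theorem stub_intr_three_e4_rung : Sig.stub_intr_three_e4_rung := by
  sorry

/-- Composition: on an intrinsic non-CM row, `p ≥ 5` with `ρ̄` onto is either a Fouquet SEED ROW (closed by
the landed road over the cite-level fact) or a Kurihara-certificate row (Kim's published theorem, per
pair); `p = 3` tower-onto with `E(ℚ₃)[3] = 0` is rung W2's leaf + the level-shifted certificate; the rest is
the displayed residue. Concludes the child crux BY NAME. -/
theorem TameLowerIntrinsicNonCM_of (hpub : Sig.stub_intr_publishedInputs) (hPRE : Sig.stub_intr_seedInputPRE)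
    (hK : Sig.stub_intr_kuriharaCerts_offSeed) (hK3 : Sig.stub_intr_kuriharaCerts_three)
    (hres : Sig.stub_intr_residualNonCM) : TameLowerIntrinsicNonCM := by
  obtain ⟨hKim, hKim3, hGZK, hmod, hF, hFibB, hFibA⟩ := hpub
  intro W _ _ p _ hr hp2 hadd hT hCM hI
  by_cases hA : 5 ≤ p ∧ Surj W p
  · obtain ⟨hp5, hsurj⟩ := hA
    by_cases hfibB : FibreRowB W p
    · -- FOUQUET 2024 fibre road, SEED-FREE (refereed chain; the Galois binder is displayed)
      obtain ⟨_, hram, hlev, hline⟩ := hfibB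
      exact tameLowerHalf_fouquetFibreLineRows_levelNotOneModP_of_fact hFibB hGZK hmod W p hr hp5 hadd hT hsurj hram
        hlev hline
    by_cases hfibA : FibreRowA W p
    · -- FOUQUET 2024 fibre road, shape certified by a congruent good-ordinary curve
      obtain ⟨_, hram, hlev, G, hGe, hGm, hord, hnak, hcong⟩ := hfibA
      exact tameLowerHalf_fouquetFibreShapeRows_levelNotOneModP_of_fact hFibA hGZK hmod W p hr hp5 hadd hT hsurj hram
        hlev ⟨G, hGe, hGm, hord, hnak, hcong⟩
    by_cases hseedA : SeedRowA W p
    · -- TIER A: refereed chain (Nakamura's zeta morphism)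
      obtain ⟨hgen, helig, hG⟩ := hseedA
      exact tameLowerHalf_fouquetSeedRows_of_nakamuraTateFact hF hGZK hmod W p hr hp5 hadd hT hsurj hgen helig hG
    by_cases hseed : SeedRowB W p
    · -- TIER B: Fouquet as printed; Colmez–Wang inside (the separately displayed input `hPRE`)
      obtain ⟨hgen, helig, hG⟩ := hseed
      exact tameLowerHalf_fouquetSeedRows_of_sigmaTateFact hPRE hGZK hmod W p hr hp5 hadd hT hsurj hgen helig hG
    · obtain ⟨N, _, D, hc, hper, k, n, _, hk, hkt, hn, hcyc, ψ, hψ, hδ⟩ :=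
        hK W p hr hp5 hadd hT hsurj hCM hI hfibB hfibA hseed
      exact tameMissingLowerBoundAt_rankZero_of_kimLower hKim hGZK hmod W p hr hp5 hadd hT hsurj D hc
        hper k n hk hkt hn hcyc ψ hψ hδ
  · by_cases hB : p = 3 ∧ (∀ n : ℕ, W.HasSurjectiveModNGaloisRep (p ^ n : ℕ)) ∧
        Nat.card {Q : (W.baseChange ℚ_[p]).toAffine.Point // (p : ℕ) • Q = 0} = 1
    · obtain ⟨rfl, htower, ht0⟩ := hB
      obtain ⟨N, _, D, hc, hper, k, n, _, hk, hkt, hn, hcyc, ψ, hψ, hδ⟩ :=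
        hK3 W hr hadd hT htower ht0 hCM hI
      exact tameMissingLowerBoundAt_three_of_kimAtThree_of_indexCert hKim3 hGZK hmod W hr hadd hT htower
        ht0 D hc hper hk hn hcyc ψ hψ hδ hkt
    · exact hres W p hr hp2 hadd hT (by rintro (h | h) <;> [exact hA h; exact hB h]) hCM hI

/-- The child crux from the (sorried) stubs — records that the stub set is complete. -/
theorem tameLowerIntrinsicNonCM_of_stubs : TameLowerIntrinsicNonCM :=
  TameLowerIntrinsicNonCM_of stub_intr_publishedInputs stub_intr_seedInputPRE stub_intr_kuriharaCerts_offSeed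
    stub_intr_kuriharaCerts_three stub_intr_residualNonCM

end Summit.BirchSwinnertonDyer.BirchSwinnertonDyer.Cruxes.TameLowerIntrinsicNonCM.Birth

end
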